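import Mathlib
import HarnessLib
import Summits.Langlands.Langlands.Theses.ExteriorSquareAscent
import Literature.NumberTheory.Automorphic.TunnellOctahedralGlobal
import Literature.NumberTheory.Automorphic.BaseChangeCyclicCuspidal
import Literature.NumberTheory.Automorphic.AsgariRaghuramExteriorSquareCuspidality
import Literature.NumberTheory.Automorphic.KimExteriorSquareGL4

/-!
# Birth skeleton (BC3) for crux stmt-Langlands-18053
`Summit.Langlands.Langlands.Theses.ExteriorSquareAscent.InducedSquareAscent` — line `birth`

Route `route-Langlands-ExteriorSquareAscent` (rank-2 crux, THE LEVER of the route: purely automorphic, any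
number field `K`, no Galois representation anywhere). The crux: `π` cuspidal on `GL₄(𝔸_K)`, `L/K`
quadratic, `P` cuspidal on `GL₃(𝔸_L)`, and at almost every finite `v` of `K` the exterior-square Satake
multiset `∧² t_{π,v} = {tᵢtⱼ : i < j}` equals the automorphic-induction multiset of `P` at `v` (split `v`:
`t_{P,w₁} ⊔ t_{P,w₂}`; non-split `v`: the six square roots `±√b`, `b ∈ t_{P,w}`). THEN `π` is essentially
self-dual at Satake level (a `GL(1)` datum `η` over `K` with `t_{π,v}⁻¹ = η_v · t_{π,v}` a.e.) OR `π` is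
self-twisted by the quadratic sign of some quadratic `L'/K` a.e.

This skeleton is the route's own TWO-LAYER PLAN for the crux ("InducedSquareAscent ⇐ QuadraticAscent →
ARoverL", route header), with the Arthur–Clozel base-change dichotomy split off as its own lemma, so that
each stub has ONE engine:

* `stub_cuspidalBaseChange` — **Arthur–Clozel quadratic base change, cuspidal-or-induced dichotomy
  (Satake form).** For `π` cuspidal on `GL₄(𝔸_K)` and `L/K` quadratic: either `π` is self-twisted by
  `ε_{L/K}` at Satake level a.e. (`quadraticSign L v · t_{π,v} = t_{π,v}`), or there is a CUSPIDAL `Π` on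
  `GL₄(𝔸_L)` which is a weak base-change lift of `π` (`IsWeakBaseChangeLiftAE`: `t_{Π,w} = t_{π,v}^{f(w|v)}`
  a.e.). Engine: Arthur–Clozel Ch. 3 Thm. 4.2 (a) — tree fact `baseChange_cyclic_cuspidal` — fed by an
  inert unramified place where `-t_{π,v} ≠ t_{π,v}` (which exists as soon as the first disjunct fails:
  `quadraticSign = -1` exactly at inert `v`, `inertiaDeg_eq_one_or_two_of_finrank_eq_two`), plus
  `[L : K] = 2 ⇒ L/K` Galois cyclic. Size M.
* `stub_selfDualOrSelfTwistOverL` — **Kim + Jacquet–Shalika + Asgari–Raghuram over the auxiliary field.**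
  Under the crux's matching hypothesis, a cuspidal weak base change `Π` of `π` to `L` is essentially
  self-dual at Satake level over `L` or carries a non-trivial Satake self-twist over `L` — the two
  disjuncts being VERBATIM the conclusion of the vendored fact
  `AsgariRaghuram2007_notCuspidal_wedgeTwo_imp` (file `AsgariRaghuramExteriorSquareCuspidality`). Engine:
  `∧²Π` is not cuspidal — at a.e. `w` of `L`, `wedgeTwoParams t_{Π,w} = t_{P,w} ⊔ t_{P^γ,w}` (split `w₁ | v`:
  `∧²(t_{π,v}) = t_{P,w₁} ⊔ t_{P,w₂}`; inert `w`: `∧²(t_{π,v}²) = (γ ⊔ -γ)² = β ⊔ β`, `β = t_{P,w} = t_{P^γ,w}`),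
  so a cuspidal `Σ` on `GL₆(𝔸_L)` with these parameters would equal the isobaric `P ⊞ P^γ`
  (Jacquet–Shalika Thm. 4.4) — absurd; then AR Thm. 1.1 (i) ⇒ (iii) (Langlands–Shahidi on `GSpin`, Kim;
  NO descent). Size L (the Galois conjugate `P^γ` as a datum and isobaric SMO are the work).
* `stub_quadraticAscent` — **the quadratic ASCENT (class field theory + Arthur–Clozel fibres).** If a
  cuspidal weak base change `Π` of `π` to the quadratic `L` is essentially self-dual or non-trivially
  self-twisted at Satake level over `L`, then `π` is essentially self-dual at Satake level over `K` or
  quadratically self-twisted over `K` (the crux's conclusion, verbatim). Engine: `Π^∨ ≅ Π ⊗ λ'` and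
  `t_{Π,γw} = t_{Π,w}` give the self-twist `μ = λ'^γ/λ'`; if `μ = 1`, `λ'` is `Gal(L/K)`-invariant, hence
  `λ' = λ₀ ∘ N_{L/K}` (`H¹(Gal(L/K), C_L) = 0`, Tate `Ĥ⁻¹ ≅ Ĥ¹` for cyclic groups, extension from the open
  subgroup `N C_L`), so `(t_{π^∨,v})^{f} = (t_{π⊗λ₀,v})^{f}` a.e. and the FIBRE theorem
  (`ArthurClozel_fibres_quadratic`, tree, Satake form) gives `t_{π,v}⁻¹ = (λ₀ε^j)(ϖ_v) t_{π,v}` a.e.;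
  otherwise `Π` has a non-trivial self-twist group `T` (orders divide `4`: `ω_Π = ω_Π ξ⁴`), `γ`-stable,
  and `T[2]` has a non-zero `γ`-fixed element `ξ₁` (`ξ₁` or `ξ₁ξ₁^γ`), `ξ₁ = ξ₀ ∘ N`, whence by the fibre
  theorem `π` is Satake-self-twisted by `χ = ξ₀ε^j ≠ 1` with `χ² ∈ {1, ε_{L/K}}`; `χ² = ε_{L/K}` would make
  `π` `ε_{L/K}`-self-twisted, i.e. induced from `GL₂(𝔸_L)`, contradicting the CUSPIDALITY of the weak
  base change `Π` (Arthur–Clozel Thm. 4.2 (b) + Jacquet–Shalika); so `χ` is quadratic, `χ = ε_{L'/K}`,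
  `χ(ϖ_v) = quadraticSign L' v`. Size L. This is the stub that carries the crux's recorded
  `why it might fail` ("an overlooked exceptional fibre of quadratic base change / a non-γ-invariant
  similitude character escaping both branches").
* `InducedSquareAscent_of` — **the composition, kernel-checked (no `sorry`):** case on
  `stub_cuspidalBaseChange`; the self-twisted branch IS the crux's second disjunct with `L' := L`
  (`quadraticSign` is definitionally the crux's inline `if … then 1 else -1`); on the cuspidal branch feed
  `Π` to `stub_selfDualOrSelfTwistOverL` and its output to `stub_quadraticAscent`. Level witnesses over
  `L` are the tree theorem `isCompact_glFiniteIntegralLevel_holds`. Concludes the route decl BY NAME.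

Honest reading of the cut: stub A is Arthur–Clozel as printed (a vendored fact plus place bookkeeping);
stub B is where Kim's `∧²`, its compatibility with base change (trivial on Satake parameters), isobaric
strong multiplicity one and AR's criterion are spent; stub C is the new piece of the route (the ascent
along `L/K`), elementary but with the exceptional fibres of quadratic base change to be tracked exactly.
No stub mentions `P` except B; no stub mentions the `GL(1)` data over `K` except C; none is the crux or
the summit reworded (BC3 probes `stub → InducedSquareAscent`, `stub → Langlands` by
`first | exact? | simpa | aesop` fail, see NOTES/evidence).

Disproof used: none on file for this crux (`ledger crux ls stmt-Langlands-18053`: no workfiles, no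
`Disproof.lean`, no `Negative/` lemmas, 2026-08-17).

Notation: in the Lean text the base change `Π = BC_L π` is the bound variable `Q` (`Π` is a reserved token
of Mathlib's binder notation).

Shape (for `ledger skeleton check` / `#h21_check_skeleton`): stubs `theorem stub_<name> : <signature> := by
sorry` stated over tree declarations only (`Literature.NumberTheory.Automorphic.CuspidalAutomorphicRepData`,
`AutomorphicRepData.HasSatakeParamAt`, `isCompact_glFiniteIntegralLevel`, `IsWeakBaseChangeLiftAE`,
`quadraticSign`, Mathlib `IsDedekindDomain.HeightOneSpectrum`, `Ideal.under`, `Ideal.inertiaDeg`,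
`Multiset.powersetCard`); `_Goal.stub_<name> : Prop := type_of% @stub_<name>` names each statement; the
composition `InducedSquareAscent_of (hA : _Goal.stub_cuspidalBaseChange) (hB : _Goal.stub_selfDualOrSelfTwistOverL)
(hC : _Goal.stub_quadraticAscent) : InducedSquareAscent` is proved without `sorry`.
-/

set_option linter.dupNamespace false
set_option linter.unusedVariables false

noncomputable section

namespace Summit.Langlands.Langlands.Cruxes.InducedSquareAscent.Birth

open scoped Classical NumberField
open Filter IsDedekindDomain NumberField
open Summit.Langlands.Langlands.Theses.ExteriorSquareAscent
open Literature.NumberTheory.Automorphic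

/-! ## 1. The three stubs -/

/-- **STUB A — cuspidal quadratic base change or quadratic self-twist (Arthur–Clozel, Satake form).**
Let `π` be a cuspidal automorphic representation of `GL₄(𝔸_K)` and `L/K` a quadratic extension of number
fields. Then EITHER `π` is self-twisted by the quadratic sign of `L/K` at Satake level at almost every
finite place (`ε_{L/K}(v) · t_{π,v} = t_{π,v}`; the unramified shadow of `π ≅ π ⊗ η_{L/K}`, i.e. `π`
automorphically induced from `GL₂(𝔸_L)`, Arthur–Clozel Thm. 4.2 (b)), OR (for every level witness `hL4`)
there is a CUSPIDAL automorphic representation `Π = BC_{L/K}(π)` of `GL₄(𝔸_L)` which is a weak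
base-change lift of `π`: `t_{Π,w} = t_{π,v}^{f(w|v)}` for almost all `w` (`IsWeakBaseChangeLiftAE`).
Proof line: if the first disjunct fails, it fails at infinitely many `v`, all inert (at split or
ramified `v` the sign is `+1`), so some unramified inert `v` carries a Satake parameter `α` with
`{-a} ≠ {a}` — the hypothesis of the tree fact `baseChange_cyclic_cuspidal` (Thm. 4.2 (a)), `L/K` being
Galois cyclic of prime degree `2`. Size M.
[cite: ArthurClozelAMS120, Ch. 3, Thm. 4.2 (a)–(b) with Def. 1.1 and the proof of Thm. 3.1] -/
theorem stub_cuspidalBaseChange :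
    ∀ (K : Type) [Field K] [NumberField K] (hcpt : isCompact_glFiniteIntegralLevel 4 K)
      (π : CuspidalAutomorphicRepData 4 K hcpt) (L : Type) [Field L] [NumberField L] [Algebra K L],
      Module.finrank K L = 2 → ∀ (hL4 : isCompact_glFiniteIntegralLevel 4 L),
        (∀ᶠ v : HeightOneSpectrum (𝓞 K) in cofinite, ∀ α : Multiset ℂ,
            π.1.HasSatakeParamAt v α → α.map (fun a => quadraticSign L v * a) = α) ∨
        ∃ Q : CuspidalAutomorphicRepData 4 L hL4, IsWeakBaseChangeLiftAE π.1 Q.1 := by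
  sorry

/-- **STUB B — over the auxiliary field: `∧²(BC_L π) = P ⊞ P^γ` is not cuspidal, hence `BC_L π` is
essentially self-dual or self-twisted (Kim + Jacquet–Shalika + Asgari–Raghuram).** Let `π` be cuspidal
on `GL₄(𝔸_K)`, `L/K` quadratic, `P` cuspidal on `GL₃(𝔸_L)`, and assume the crux's matching hypothesis
(verbatim): at almost every finite `v` of `K`, if `π` has Satake parameter `α` at `v` then
`∧²α = (α.powersetCard 2).map prod` (`= wedgeTwoParams α`, `wedgeTwoParams_def`) is `t_{P,w₁} + t_{P,w₂}`
for two distinct places `w₁, w₂` of `L` over `v` when `v` has a degree-one place above it, and is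
`γ + (-γ)` with `γ² = t_{P,w}` (pointwise) for a place `w` over `v` otherwise. Let `Π` be a CUSPIDAL
automorphic representation of `GL₄(𝔸_L)` which is a weak base-change lift of `π`. Then either
(α) there is a `GL(1)` datum `η` over `L` with `t_{Π,w}⁻¹ = η(ϖ_w) · t_{Π,w}` (as multisets) for almost
all `w` — `Π` essentially self-dual at Satake level — or (β) there is a `GL(1)` datum `ξ` over `L`, not
unramified-trivial at almost all places, with `ξ(ϖ_w) · t_{Π,w} = t_{Π,w}` for almost all `w` — a
non-trivial Satake self-twist. (These two disjuncts are verbatim the conclusion of the tree fact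
`AsgariRaghuram2007_notCuspidal_wedgeTwo_imp` at `F := L`.) Proof line: at almost every `w`,
`wedgeTwoParams t_{Π,w} = t_{P,w} ⊔ t_{P^γ,w}` (split `w₁ | v`: `t_{Π,w₁} = α`, `∧²α = t_{P,w₁} ⊔ t_{P,w₂}`
and `t_{P^γ,w₁} = t_{P,w₂}`; inert `w`: `t_{Π,w} = α²`, `wedgeTwoParams (α²) = (wedgeTwoParams α)² =
(γ ⊔ -γ)² = β ⊔ β`, `β = t_{P,w} = t_{P^γ,w}` as `γw = w`), so a cuspidal `Σ` on `GL₆(𝔸_L)` with Satake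
parameters `wedgeTwoParams t_{Π,w}` a.e. would be nearly equivalent to the isobaric sum `P ⊞ P^γ`,
contradicting Jacquet–Shalika's classification (Thm. 4.4); hence the hypothesis of AR Thm. 1.1
(i) ⇒ (iii) holds for `Π` over `L`, and its conclusion is (α) ∨ (β). Size L.
[cite: AsgariRaghuram2007, Thm. 1.1 (i) ⇒ (iii), §4 Props. 4.1–4.2]
[cite: Kim2003, Theorem A] [cite: JacquetShalikaAJM1981II, Thm. 4.4] -/
theorem stub_selfDualOrSelfTwistOverL :
    ∀ (K : Type) [Field K] [NumberField K] (hcpt : isCompact_glFiniteIntegralLevel 4 K)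
      (π : CuspidalAutomorphicRepData 4 K hcpt) (L : Type) [Field L] [NumberField L] [Algebra K L],
      Module.finrank K L = 2 → ∀ (hL3 : isCompact_glFiniteIntegralLevel 3 L)
        (P : CuspidalAutomorphicRepData 3 L hL3),
        (∀ᶠ v : HeightOneSpectrum (𝓞 K) in cofinite, ∀ α : Multiset ℂ, π.1.HasSatakeParamAt v α →
          ((∃ w : HeightOneSpectrum (𝓞 L), w.asIdeal.under (𝓞 K) = v.asIdeal ∧
              w.asIdeal.inertiaDeg (𝓞 K) = 1) →
            ∃ w₁ w₂ : HeightOneSpectrum (𝓞 L), w₁ ≠ w₂ ∧ w₁.asIdeal.under (𝓞 K) = v.asIdeal ∧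
              w₂.asIdeal.under (𝓞 K) = v.asIdeal ∧ ∃ β₁ β₂ : Multiset ℂ, P.1.HasSatakeParamAt w₁ β₁ ∧
                P.1.HasSatakeParamAt w₂ β₂ ∧ (α.powersetCard 2).map Multiset.prod = β₁ + β₂) ∧
          ((¬ ∃ w : HeightOneSpectrum (𝓞 L), w.asIdeal.under (𝓞 K) = v.asIdeal ∧
              w.asIdeal.inertiaDeg (𝓞 K) = 1) →
            ∃ w : HeightOneSpectrum (𝓞 L), w.asIdeal.under (𝓞 K) = v.asIdeal ∧
              ∃ β γ : Multiset ℂ, P.1.HasSatakeParamAt w β ∧ γ.map (fun c => c ^ 2) = β ∧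
                (α.powersetCard 2).map Multiset.prod = γ + γ.map (fun c => -c))) →
        ∀ (hL1 : isCompact_glFiniteIntegralLevel 1 L) (hL4 : isCompact_glFiniteIntegralLevel 4 L)
          (Q : CuspidalAutomorphicRepData 4 L hL4), IsWeakBaseChangeLiftAE π.1 Q.1 →
          (∃ η : CuspidalAutomorphicRepData 1 L hL1,
              ∀ᶠ w : HeightOneSpectrum (𝓞 L) in cofinite, ∀ β : Multiset ℂ, Q.1.HasSatakeParamAt w β →
                ∃ e : ℂ, η.1.HasSatakeParamAt w {e} ∧ β.map (fun b => b⁻¹) = β.map (fun b => e * b)) ∨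
          (∃ ξ : CuspidalAutomorphicRepData 1 L hL1,
              (¬ ∀ᶠ w : HeightOneSpectrum (𝓞 L) in cofinite, ξ.1.HasSatakeParamAt w {1}) ∧
              ∀ᶠ w : HeightOneSpectrum (𝓞 L) in cofinite, ∀ β : Multiset ℂ, Q.1.HasSatakeParamAt w β →
                ∃ e : ℂ, ξ.1.HasSatakeParamAt w {e} ∧ β.map (fun b => e * b) = β) := by
  sorry

/-- **STUB C — the quadratic ASCENT (class field theory + fibres of quadratic base change).** Let `π`
be cuspidal on `GL₄(𝔸_K)`, `L/K` quadratic, and `Π` a CUSPIDAL automorphic representation of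
`GL₄(𝔸_L)` which is a weak base-change lift of `π` (`t_{Π,w} = t_{π,v}^{f(w|v)}` a.e.). If `Π` is
essentially self-dual at Satake level over `L` (a `GL(1)` datum `η'` over `L` with
`t_{Π,w}⁻¹ = η'(ϖ_w) · t_{Π,w}` a.e.) or carries a non-trivial Satake self-twist over `L` (a `GL(1)` datum
`ξ`, not unramified-trivial a.e., with `ξ(ϖ_w) · t_{Π,w} = t_{Π,w}` a.e.), then `π` is essentially
self-dual at Satake level over `K` (a `GL(1)` datum `η` over `K` at level witness `h1` with
`t_{π,v}⁻¹ = η(ϖ_v) · t_{π,v}` a.e.) or `π` is self-twisted by the quadratic sign of some quadratic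
`L'/K` a.e. — verbatim the two disjuncts of the crux. Proof line: write `γ` for the non-trivial
automorphism of `L/K`; `t_{Π,γw} = t_{Π,w}` (both are `t_{π,v}^{f}`). (α) `t_{Π,w}⁻¹ = λ'(ϖ_w) t_{Π,w}`
a.e. gives, comparing `w` and `γw`, the Satake self-twist `μ = λ'∘γ / λ'` of `Π`. If `μ = 1`, `λ'` is
`Gal(L/K)`-invariant, so `λ' = λ₀ ∘ N_{L/K}` for a Hecke character `λ₀` of `K` (`H¹(Gal(L/K), C_L) = 0`
and `Ĥ⁻¹ ≅ Ĥ¹` for the cyclic group: `ker N = (γ-1)C_L`; extend from the open subgroup `N C_L ≤ C_K`),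
hence `(t_{π^∨,v})^{f(w|v)} = (t_{π⊗λ₀,v})^{f(w|v)}` a.e., and the fibre theorem for the quadratic base
change of the cuspidal data `π^∨`, `π ⊗ λ₀` (tree fact `ArthurClozel_fibres_quadratic`; contragredient
and twisted data: `CuspidalAutomorphicRepData.exists_contragredient_satake_holds`,
`AutomorphicRepData.eventually_hasSatakeParamAt_twist`) gives `t_{π,v}⁻¹ = (λ₀ ε_{L/K}^j)(ϖ_v) t_{π,v}`
a.e. — first disjunct, `η` the `GL(1)` datum of `λ₀ε^j` (`GLOneOfHeckeCharacterBJ`). If `μ ≠ 1`, or in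
case (β), `Π` has a non-trivial Satake self-twist; every self-twist `ξ` of the cuspidal `Π` has `ξ⁴ = 1`
(`ω_Π = ω_Π ξ⁴`, `GL(1)` strong multiplicity one), the self-twists form a `γ`-stable group `T ≠ 1`, and
`T[2]` contains a `γ`-fixed `ξ₁ ≠ 1` (`ξ₁`, or `ξ₁ · ξ₁^γ` when `ξ₁^γ ≠ ξ₁`); `ξ₁ = ξ₀ ∘ N_{L/K}` as
before, `Π` is then also a weak base change of `π ⊗ ξ₀`, and the fibre theorem gives a Satake
self-twist `χ = ξ₀ ε^j ≠ 1` of `π` with `χ² = ξ₀² ∈ {1, ε_{L/K}}`. If `χ² = ε_{L/K}` then `π` is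
`ε_{L/K}`-self-twisted, i.e. induced from `GL₂(𝔸_L)` (Thm. 4.2 (b)), and its base change `f ⊞ f^γ` is
the only lift — a CUSPIDAL weak lift `Π` contradicts Jacquet–Shalika; so `χ` is quadratic, `χ = η_{L'/K}`
for the quadratic `L'` it cuts out, and `χ(ϖ_v) = quadraticSign L' v` at unramified `v`
(`valueAtUniformizer_eq_quadraticSign_of_orderOf`) — second disjunct. Size L; carries the crux's
recorded risk (exceptional fibres of quadratic base change; a non-`γ`-invariant similitude character).
[cite: ArthurClozelAMS120, Ch. 3, Thm. 3.1 (fibres) and Thm. 4.2 (a), (b), (d)]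
[cite: LabesseLanglands1979, §6] [cite: JacquetShalikaAJM1981II, Thm. 4.4] -/
theorem stub_quadraticAscent :
    ∀ (K : Type) [Field K] [NumberField K] (h1 : isCompact_glFiniteIntegralLevel 1 K)
      (hcpt : isCompact_glFiniteIntegralLevel 4 K) (π : CuspidalAutomorphicRepData 4 K hcpt)
      (L : Type) [Field L] [NumberField L] [Algebra K L], Module.finrank K L = 2 →
      ∀ (hL1 : isCompact_glFiniteIntegralLevel 1 L) (hL4 : isCompact_glFiniteIntegralLevel 4 L)
        (Q : CuspidalAutomorphicRepData 4 L hL4), IsWeakBaseChangeLiftAE π.1 Q.1 →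
        ((∃ η' : CuspidalAutomorphicRepData 1 L hL1,
              ∀ᶠ w : HeightOneSpectrum (𝓞 L) in cofinite, ∀ β : Multiset ℂ, Q.1.HasSatakeParamAt w β →
                ∃ e : ℂ, η'.1.HasSatakeParamAt w {e} ∧ β.map (fun b => b⁻¹) = β.map (fun b => e * b)) ∨
          (∃ ξ : CuspidalAutomorphicRepData 1 L hL1,
              (¬ ∀ᶠ w : HeightOneSpectrum (𝓞 L) in cofinite, ξ.1.HasSatakeParamAt w {1}) ∧
              ∀ᶠ w : HeightOneSpectrum (𝓞 L) in cofinite, ∀ β : Multiset ℂ, Q.1.HasSatakeParamAt w β →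
                ∃ e : ℂ, ξ.1.HasSatakeParamAt w {e} ∧ β.map (fun b => e * b) = β)) →
        (∃ η : CuspidalAutomorphicRepData 1 K h1,
            ∀ᶠ v : HeightOneSpectrum (𝓞 K) in cofinite, ∀ α : Multiset ℂ, π.1.HasSatakeParamAt v α →
              ∃ e : ℂ, η.1.HasSatakeParamAt v {e} ∧ α.map (fun a => a⁻¹) = α.map (fun a => e * a)) ∨
        (∃ (L' : Type) (_ : Field L') (_ : NumberField L') (_ : Algebra K L'), Module.finrank K L' = 2 ∧
            ∀ᶠ v : HeightOneSpectrum (𝓞 K) in cofinite, ∀ α : Multiset ℂ, π.1.HasSatakeParamAt v α →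
              α.map (fun a => quadraticSign L' v * a) = α) := by
  sorry

/-! ## 2. The stub statements as named `Prop`s (literally their types) -/

namespace _Goal

/-- The statement of `stub_cuspidalBaseChange`, as a named `Prop` (literally its type). [folklore] -/
def stub_cuspidalBaseChange : Prop :=
  type_of% @Summit.Langlands.Langlands.Cruxes.InducedSquareAscent.Birth.stub_cuspidalBaseChange

/-- The statement of `stub_selfDualOrSelfTwistOverL`, as a named `Prop` (literally its type). [folklore] -/
def stub_selfDualOrSelfTwistOverL : Prop :=
  type_of% @Summit.Langlands.Langlands.Cruxes.InducedSquareAscent.Birth.stub_selfDualOrSelfTwistOverL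

/-- The statement of `stub_quadraticAscent`, as a named `Prop` (literally its type). [folklore] -/
def stub_quadraticAscent : Prop :=
  type_of% @Summit.Langlands.Langlands.Cruxes.InducedSquareAscent.Birth.stub_quadraticAscent

end _Goal

/-! ## 3. The composition (kernel-checked, no `sorry`): BASE CHANGE → AR OVER `L` → ASCENT → the crux -/

/-- **`InducedSquareAscent` from the three stubs.** Fix `K, π, L, P` and the matching hypothesis of the
crux. By `stub_cuspidalBaseChange` either `π` is `ε_{L/K}`-self-twisted at Satake level a.e. — which IS
the crux's second disjunct with `L' := L` (`quadraticSign L v` is by definition the crux's inline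
`if ∃ w ∣ v, f(w|v) = 1 then 1 else -1`) — or `BC_L π` is a cuspidal `Π`; then
`stub_selfDualOrSelfTwistOverL` makes `Π` essentially self-dual or non-trivially self-twisted over `L`,
and `stub_quadraticAscent` carries either property down to `π`. The level witnesses over `L` are the
tree theorem `isCompact_glFiniteIntegralLevel_holds`. The hypotheses are, by name, the statements of
the three stubs; the conclusion is the route decl
`Summit.Langlands.Langlands.Theses.ExteriorSquareAscent.InducedSquareAscent`. [folklore] -/
theorem InducedSquareAscent_of (hA : _Goal.stub_cuspidalBaseChange)
    (hB : _Goal.stub_selfDualOrSelfTwistOverL) (hC : _Goal.stub_quadraticAscent) :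
    Summit.Langlands.Langlands.Theses.ExteriorSquareAscent.InducedSquareAscent := by
  -- the stub statements, as the Π-types they literally are
  have hA' : type_of% @stub_cuspidalBaseChange := hA
  have hB' : type_of% @stub_selfDualOrSelfTwistOverL := hB
  have hC' : type_of% @stub_quadraticAscent := hC
  intro K _ _ h1 hcpt π L _ _ _ hdeg hL3 P hmatch
  rcases hA' K hcpt π L hdeg (isCompact_glFiniteIntegralLevel_holds 4 L) with hst | ⟨Q, hQ⟩
  · -- `π ≅ π ⊗ ε_{L/K}` at Satake level: the crux's second disjunct with `L' := L`
    exact Or.inr ⟨L, inferInstance, inferInstance, inferInstance, hdeg, hst⟩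
  · -- `BC_L π = Π` is cuspidal: AR over `L`, then the ascent along `L/K`
    have hL := hB' K hcpt π L hdeg hL3 P hmatch (isCompact_glFiniteIntegralLevel_holds 1 L)
      (isCompact_glFiniteIntegralLevel_holds 4 L) Q hQ
    exact hC' K h1 hcpt π L hdeg (isCompact_glFiniteIntegralLevel_holds 1 L)
      (isCompact_glFiniteIntegralLevel_holds 4 L) Q hQ hL

/-- By-name sanity check (an `example`, not a declaration of the file): the three stubs feed the
composition as they stand. -/
example : Summit.Langlands.Langlands.Theses.ExteriorSquareAscent.InducedSquareAscent :=
  InducedSquareAscent_of stub_cuspidalBaseChange stub_selfDualOrSelfTwistOverL stub_quadraticAscent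

end Summit.Langlands.Langlands.Cruxes.InducedSquareAscent.Birth

end
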